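import Mathlib
import HarnessLib
import Summits.HubbardSuperconductivity.HubbardSuperconductivity.Theorems.KLProgrammeKLRegimeTwoPointAssemblyDiag
import Summits.HubbardSuperconductivity.HubbardSuperconductivity.Theorems.KLProgrammeKLRegimeTwoPointAssemblyRepr
import Summits.HubbardSuperconductivity.HubbardSuperconductivity.Theorems.KLProgrammeKLRegimeTwoPointAssemblyFrame
import Summits.HubbardSuperconductivity.HubbardSuperconductivity.Theorems.KLProgrammeKLRegimeVolumeLimitZeroCoupling
import Literature.MathematicalPhysics.QuantumLattice.HubbardCovarianceFrameResolvent

/-!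
# Child 5 `KLRegimeVolumeLimitV7` (stmt-HubbardSuperconductivity-19665) — FRAME REDUCTION of the carrier of the volume-limit text:
# the two-leg kernel of the fully integrated countertermed action is the bare momentum-space two-point ratio, re-amputated with
# the frame propagator (every `U`, every frame `K`, finite `(β, L, M)`; seat hubbard-kl-k3c5-p2)

For every coupling `U` at which the bare normalised partition function `D_{L,M}(U) = ∫dμ_C e^{−V}` does not vanish:

  `βL² · ĝ_K(k)² · Σ̂^K_{L,M}(k, σ; U) = N_{L,M}(k, σ; U) / D_{L,M}(U) + βL² · ĝ_K(k)`,

`N_{L,M}(k,σ;U) = ∫dμ_C ψ̂⁺_{kσ} ψ̂⁻_{kσ} e^{−V}` the bare (frame-FREE) un-normalised momentum-space two-point function, `ĝ_K = propCT` the free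
propagator of the frame, `Σ̂^K = selfEnergy (fullActionCT … U … K)` (`selfEnergy_fullActionCT_frame_reduction`; solved form
`selfEnergy_fullActionCT_eq_bare_ratio`).  Ingredients, all in the tree: the two-point identity of the effective action
(`gaussExpect_gen_mul_gen_mul_grassmannExp_neg`, `…GrassmannRepr`), the counterterm measure change «same model, frame moved»
(`gaussExpect_hubbardCovarianceCT_counterterm_mul`, `grassmannExp_neg_hubbardInteractionCT`), the diagonal collapse of the label sums
(`…Diag`).  CONSEQUENCES.  (1) The frame `K` enters the carrier `klSelfEnergy … (nScales β + 1)` of `FinalTwoLegVolLimit β U μ K Mstar` only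
through the explicit, momentum-continuous factors `ĝ_K(ω_n, p)^{±1}`: the volume-limit content of child 5 is FRAME-FREE — the thermodynamic
limit, per Matsubara integer and uniformly on the momentum grid, of the interacting momentum-space two-point ratio `N/D` of the bare torus
(the object of the tree's `bgm_two_point_limit` programme, `HubbardTruncatedCoeff*`), not a statement about the frame.  (2) For child 4
(`…-19666`): `reprFree + reprInt = [σ = σ'] (βL²)⁻² Σ_k e^{ip·(x̄−ȳ)} N(k,σ;U)/D(U)` (`reprFree_add_reprInt_eq_bare`) — the `K`-dependence of
the two diagonal sums cancels identically, so the limit `S` of child 4 is manifestly frame-independent.  (3) At `U = 0`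
(`N/D = −βL² ĝ₀`) this is `…VolumeLimitZeroCoupling.propCT_zero_frame_eq_sub`.  Everything is proved; no definition.
-/

noncomputable section

namespace Summit.HubbardSuperconductivity.HubbardSuperconductivity.Theorems.TwoPointAssembly

set_option linter.dupNamespace false -- summit = problem name (single-conjunct summit), D-0017

open Finset Literature.MathematicalPhysics.QuantumLattice Literature.Probability.LatticeModels GrassmannAlgebra
open Summit.HubbardSuperconductivity.HubbardSuperconductivity.Theorems.KLRegimeSplit
open Summit.HubbardSuperconductivity.HubbardSuperconductivity.Theorems.KLProgrammeLegKernels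

variable {L M : ℕ} [NeZero L]

/-! ## §1 Same model, frame moved: the normalised partition functions -/

/-- `e^{−𝒩_K}` is even (hence central). -/
theorem grassmannExp_neg_counterQuadratic_mem_evenOdd_zero (β : ℝ) (K : TrigPolyC4v) :
    grassmannExp (-(counterQuadratic L M β K)) ∈ evenOdd ℂ 0 :=
  grassmannExp_mem_evenOdd_zero ℂ (neg_mem (counterQuadratic_even L M β K))
    (isNilpotent_of_constPart_eq_zero ℂ (by rw [map_neg, constPart_counterQuadratic, neg_zero]))

/-- **`Z^K_CT(U) = Z_K · D(U)`**: the normalised partition function of `(C^K, V_K)` is the Gaussian normalisation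
`Z_K = ∫dμ_{C^K} e^{−𝒩_K}` times the bare one `D(U) = ∫dμ_C e^{−V}` (`β ≠ 0`). -/
theorem effPartitionFn_CT_eq_mul_bare {β : ℝ} (hβ : β ≠ 0) (U μ : ℝ) (K : TrigPolyC4v) :
    effPartitionFn ℂ (hubbardCovarianceCT L M β μ 0 K) (hubbardInteractionCT L M β U K) =
      gaussExpect ℂ (hubbardCovarianceCT L M β μ 0 K) (grassmannExp (-(counterQuadratic L M β K))) *
        effPartitionFn ℂ (hubbardCovariance L M β μ 0) (hubbardInteraction L M β U) := by
  rw [effPartitionFn_eq_gaussExpect, effPartitionFn_eq_gaussExpect, grassmannExp_neg_hubbardInteractionCT,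
    gaussExpect_hubbardCovarianceCT_counterterm_mul L M μ 0 K hβ]

/-- **The un-normalised CT two-point function is `Z_K` times the bare one**:
`∫dμ_{C^K} ψ̂⁺_{kσ}ψ̂⁻_{kσ} e^{−V_K} = Z_K · ∫dμ_C ψ̂⁺_{kσ}ψ̂⁻_{kσ} e^{−V}`. -/
theorem gaussExpect_CT_genPair_eq_mul_bare {β : ℝ} (hβ : β ≠ 0) (U μ : ℝ) (K : TrigPolyC4v) (a b : HubbardFieldIdx L M) :
    gaussExpect ℂ (hubbardCovarianceCT L M β μ 0 K) (gen ℂ a * gen ℂ b * grassmannExp (-(hubbardInteractionCT L M β U K))) =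
      gaussExpect ℂ (hubbardCovarianceCT L M β μ 0 K) (grassmannExp (-(counterQuadratic L M β K))) *
        gaussExpect ℂ (hubbardCovariance L M β μ 0) (gen ℂ a * gen ℂ b * grassmannExp (-(hubbardInteraction L M β U))) := by
  have hc := (commute_of_mem_evenOdd_zero ℂ (grassmannExp_neg_counterQuadratic_mem_evenOdd_zero (L := L) (M := M) β K)
    (gen ℂ a * gen ℂ b)).eq
  rw [grassmannExp_neg_hubbardInteractionCT, ← mul_assoc, ← hc, mul_assoc,
    gaussExpect_hubbardCovarianceCT_counterterm_mul L M μ 0 K hβ]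

/-! ## §2 The frame reduction of the two-leg kernel -/

/-- **FRAME REDUCTION.**  For every `U` with `D(U) = ∫dμ_C e^{−V} ≠ 0` (`β ≠ 0`):
`βL² ĝ_K(k)² Σ̂^K(k,σ;U) = N(k,σ;U)/D(U) + βL² ĝ_K(k)`, `N = ∫dμ_C ψ̂⁺_{kσ}ψ̂⁻_{kσ}e^{−V}` bare and frame-free. -/
theorem selfEnergy_fullActionCT_frame_reduction {β : ℝ} (hβ : β ≠ 0) (U μ : ℝ) (K : TrigPolyC4v) (k : FreqMomentum L M) (σ : Fin 2)
    (hD : effPartitionFn ℂ (hubbardCovariance L M β μ 0) (hubbardInteraction L M β U) ≠ 0) :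
    ((β * (L : ℝ) ^ 2 : ℝ) : ℂ) * propCT L M β μ K k ^ 2 * selfEnergy L M β (fullActionCT L M β U μ K) k σ =
      gaussExpect ℂ (hubbardCovariance L M β μ 0)
          (gen ℂ (((k, σ), 0) : HubbardFieldIdx L M) * gen ℂ (((k, σ), 1) : HubbardFieldIdx L M) *
            grassmannExp (-(hubbardInteraction L M β U))) /
        effPartitionFn ℂ (hubbardCovariance L M β μ 0) (hubbardInteraction L M β U) +
      ((β * (L : ℝ) ^ 2 : ℝ) : ℂ) * propCT L M β μ K k := by
  have hβL : ((β * (L : ℝ) ^ 2 : ℝ) : ℂ) ≠ 0 := by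
    have hL : (L : ℝ) ≠ 0 := by exact_mod_cast NeZero.ne L
    exact_mod_cast mul_ne_zero hβ (pow_ne_zero 2 hL)
  set a : HubbardFieldIdx L M := ((k, σ), 0) with ha
  set b : HubbardFieldIdx L M := ((k, σ), 1) with hb
  set ZK : ℂ := gaussExpect ℂ (hubbardCovarianceCT L M β μ 0 K) (grassmannExp (-(counterQuadratic L M β K))) with hZK
  set D : ℂ := effPartitionFn ℂ (hubbardCovariance L M β μ 0) (hubbardInteraction L M β U) with hDdef
  set N : ℂ := gaussExpect ℂ (hubbardCovariance L M β μ 0) (gen ℂ a * gen ℂ b * grassmannExp (-(hubbardInteraction L M β U)))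
    with hN
  have hZK0 : ZK ≠ 0 := gaussExpect_counterQuadratic_ne_zero β μ 0 K hβ
  have hZCT : effPartitionFn ℂ (hubbardCovarianceCT L M β μ 0 K) (hubbardInteractionCT L M β U K) = ZK * D :=
    effPartitionFn_CT_eq_mul_bare hβ U μ K
  have hZ : effPartitionFn ℂ (hubbardCovarianceCT L M β μ 0 K) (hubbardInteractionCT L M β U K) ≠ 0 := by
    rw [hZCT]; exact mul_ne_zero hZK0 hD
  -- the generic two-point identity in the frame `K`
  have hgen := gaussExpect_gen_mul_gen_mul_grassmannExp_neg ℂ (hubbardCovarianceCT L M β μ 0 K)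
    (hubbardInteractionCT_mem_evenOdd_zero L M β U K) (constPart_hubbardInteractionCT L M β U K) (isUnit_iff_ne_zero.2 hZ) a b
  -- collapse the label sums
  have hinner : ∑ Y : HubbardFieldIdx L M, ∑ Z : HubbardFieldIdx L M,
      contr ℂ (hubbardCovarianceCT L M β μ 0 K) a Y * contr ℂ (hubbardCovarianceCT L M β μ 0 K) b Z *
        constPart ℂ (grassmannDeriv ℂ Z (grassmannDeriv ℂ Y
          (effAction ℂ (hubbardCovarianceCT L M β μ 0 K) (hubbardInteractionCT L M β U K)))) =
      contr ℂ (hubbardCovarianceCT L M β μ 0 K) a b * contr ℂ (hubbardCovarianceCT L M β μ 0 K) b a *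
        constPart ℂ (grassmannDeriv ℂ a (grassmannDeriv ℂ b (fullActionCT L M β U μ K))) := by
    rw [← fullActionCT]
    rw [Finset.sum_eq_single b]
    · rw [Finset.sum_eq_single a]
      · intro Z _ hZ'; rw [contr_minus_eq_zero β μ K k σ hZ', mul_zero, zero_mul]
      · intro h; exact absurd (Finset.mem_univ _) h
    · intro Y _ hY
      exact Finset.sum_eq_zero fun Z _ => by rw [contr_plus_eq_zero β μ K k σ hY, zero_mul, zero_mul]
    · intro h; exact absurd (Finset.mem_univ _) h
  rw [gaussExpect_CT_genPair_eq_mul_bare hβ, hinner, contr_plus_minus hβ, contr_minus_plus hβ, constPart_dd_fullActionCT_eq hβ,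
    hZCT] at hgen
  rw [← hZK, ← hN] at hgen
  -- cancel `Z_K` and clear `D`
  set c : ℂ := ((β * (L : ℝ) ^ 2 : ℝ) : ℂ) with hc
  have hcancel : -(c * propCT L M β μ K k) * (c * propCT L M β μ K k) *
      -(selfEnergy L M β (fullActionCT L M β U μ K) k σ / c) =
      c * propCT L M β μ K k ^ 2 * selfEnergy L M β (fullActionCT L M β U μ K) k σ := by
    field_simp
  rw [hcancel, mul_assoc ZK D] at hgen
  have h := mul_left_cancel₀ hZK0 hgen
  -- `N = D (−c ĝ + c ĝ² Σ̂)`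
  rw [h]
  field_simp
  ring

/-- **Solved form**: `Σ̂^K(k,σ;U) = (N(k,σ;U)/D(U) + βL² ĝ_K(k)) / (βL² ĝ_K(k)²)` — the bare momentum-space two-point ratio re-amputated
with the frame propagator (Möbius in `N/D`; the frame enters only through `ĝ_K`). -/
theorem selfEnergy_fullActionCT_eq_bare_ratio {β : ℝ} (hβ : β ≠ 0) (U μ : ℝ) (K : TrigPolyC4v) (k : FreqMomentum L M) (σ : Fin 2)
    (hD : effPartitionFn ℂ (hubbardCovariance L M β μ 0) (hubbardInteraction L M β U) ≠ 0) :
    selfEnergy L M β (fullActionCT L M β U μ K) k σ =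
      (gaussExpect ℂ (hubbardCovariance L M β μ 0)
            (gen ℂ (((k, σ), 0) : HubbardFieldIdx L M) * gen ℂ (((k, σ), 1) : HubbardFieldIdx L M) *
              grassmannExp (-(hubbardInteraction L M β U))) /
          effPartitionFn ℂ (hubbardCovariance L M β μ 0) (hubbardInteraction L M β U) +
        ((β * (L : ℝ) ^ 2 : ℝ) : ℂ) * propCT L M β μ K k) /
      (((β * (L : ℝ) ^ 2 : ℝ) : ℂ) * propCT L M β μ K k ^ 2) := by
  have hβL : ((β * (L : ℝ) ^ 2 : ℝ) : ℂ) ≠ 0 := by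
    have hL : (L : ℝ) ≠ 0 := by exact_mod_cast NeZero.ne L
    exact_mod_cast mul_ne_zero hβ (pow_ne_zero 2 hL)
  have hg := propCT_ne_zero (L := L) hβ μ K k
  rw [eq_div_iff (mul_ne_zero hβL (pow_ne_zero 2 hg)), ← selfEnergy_fullActionCT_frame_reduction hβ U μ K k σ hD]
  ring

/-- **The carrier of the VL text, frame-reduced**: for `β > 0` and `D(U) ≠ 0`,
`βL² ĝ_K(k)² · klSelfEnergy L M β U μ K klE0 (nScales β + 1) k σ = N(k,σ;U)/D(U) + βL² ĝ_K(k)`. -/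
theorem klSelfEnergy_nScales_succ_frame_reduction {β : ℝ} (hβ : 0 < β) (U μ : ℝ) (K : TrigPolyC4v) (k : FreqMomentum L M)
    (σ : Fin 2) (hD : effPartitionFn ℂ (hubbardCovariance L M β μ 0) (hubbardInteraction L M β U) ≠ 0) :
    ((β * (L : ℝ) ^ 2 : ℝ) : ℂ) * propCT L M β μ K k ^ 2 * klSelfEnergy L M β U μ K klE0 (nScales β + 1) k σ =
      gaussExpect ℂ (hubbardCovariance L M β μ 0)
          (gen ℂ (((k, σ), 0) : HubbardFieldIdx L M) * gen ℂ (((k, σ), 1) : HubbardFieldIdx L M) *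
            grassmannExp (-(hubbardInteraction L M β U))) /
        effPartitionFn ℂ (hubbardCovariance L M β μ 0) (hubbardInteraction L M β U) +
      ((β * (L : ℝ) ^ 2 : ℝ) : ℂ) * propCT L M β μ K k := by
  rw [klSelfEnergy, klEffectiveAction_nScales_succ L M hβ, ← fullActionCT]
  exact selfEnergy_fullActionCT_frame_reduction hβ.ne' U μ K k σ hD

/-! ## §3 Consequence for child 4: the frame cancels between the two diagonal sums -/

/-- **`reprFree + reprInt` is frame-free**: `= [σ = σ'] (βL²)⁻² Σ_k e^{ip·(x̄−ȳ)} N(k,σ;U)/D(U)` whenever `D(U) ≠ 0` — the Fourier sum of the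
bare momentum-space two-point ratio; the `K`-dependence of `reprFree` and `reprInt` cancels identically. -/
theorem reprFree_add_reprInt_eq_bare {β : ℝ} (hβ : β ≠ 0) (U μ : ℝ) (K : TrigPolyC4v) (σ σ' : Fin 2) (xe ye : TorusSite 2 L)
    (hD : effPartitionFn ℂ (hubbardCovariance L M β μ 0) (hubbardInteraction L M β U) ≠ 0) :
    reprFree L M β μ K σ σ' xe ye + reprInt L M β U μ K σ σ' xe ye =
      if σ = σ' then
        (∑ k : FreqMomentum L M, sitePhase L k.2 xe ye *
            (gaussExpect ℂ (hubbardCovariance L M β μ 0)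
                (gen ℂ (((k, σ), 0) : HubbardFieldIdx L M) * gen ℂ (((k, σ), 1) : HubbardFieldIdx L M) *
                  grassmannExp (-(hubbardInteraction L M β U))) /
              effPartitionFn ℂ (hubbardCovariance L M β μ 0) (hubbardInteraction L M β U))) /
          (((β * (L : ℝ) ^ 2 : ℝ) : ℂ) ^ 2)
      else 0 := by
  have hβL : ((β * (L : ℝ) ^ 2 : ℝ) : ℂ) ≠ 0 := by
    have hL : (L : ℝ) ≠ 0 := by exact_mod_cast NeZero.ne L
    exact_mod_cast mul_ne_zero hβ (pow_ne_zero 2 hL)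
  by_cases hσ : σ = σ'
  · rw [reprFree, reprInt, if_pos hσ, if_pos hσ, if_pos hσ]
    set c : ℂ := ((β * (L : ℝ) ^ 2 : ℝ) : ℂ) with hc
    have hk : ∀ k : FreqMomentum L M,
        sitePhase L k.2 xe ye * propCT L M β μ K k ^ 2 * selfEnergy L M β (fullActionCT L M β U μ K) k σ -
            sitePhase L k.2 xe ye * propCT L M β μ K k =
          sitePhase L k.2 xe ye *
              (gaussExpect ℂ (hubbardCovariance L M β μ 0)
                  (gen ℂ (((k, σ), 0) : HubbardFieldIdx L M) * gen ℂ (((k, σ), 1) : HubbardFieldIdx L M) *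
                    grassmannExp (-(hubbardInteraction L M β U))) /
                effPartitionFn ℂ (hubbardCovariance L M β μ 0) (hubbardInteraction L M β U)) / c := by
      intro k
      have h := selfEnergy_fullActionCT_frame_reduction hβ U μ K k σ hD
      rw [← hc] at h
      rw [eq_div_iff hβL]
      linear_combination sitePhase L k.2 xe ye * h
    rw [show ∀ A B : ℂ, -A / c + B / c = (B - A) / c from fun A B => by ring, ← Finset.sum_sub_distrib,
      Finset.sum_congr rfl fun k _ => hk k, ← Finset.sum_div]
    field_simp
  · rw [reprFree, reprInt, if_neg hσ, if_neg hσ, if_neg hσ, add_zero]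

end Summit.HubbardSuperconductivity.HubbardSuperconductivity.Theorems.TwoPointAssembly

end
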